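import Mathlib
import HarnessLib
import Summits.CriticalPhenomena.Ising3DConformalLimit.Theses.ArmDressing
import Literature.Probability.LatticeModels.RandomClusterDomainMarkov
import Literature.Barriers.CriticalPhenomena.RandomClusterFirstOrderProofs
import Literature.Probability.LatticeModels.CriticalFKIsingThinnedConnectionLaws
import Summits.CriticalPhenomena.Ising3DConformalLimit.Theorems.ArmDressingEvenPatternDecouplingPatternBoxLimits

/-!
# Box limit of the reading-family pattern event of the crux `ArmDressing.EvenPatternDecoupling`:
# the stub `stub_readingPatternBoxLimit` (route ArmDressing, item stmt-CriticalPhenomena-16133,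
# line `registered`, skeleton revision 4)

For the wired critical FK-Ising boxes `Λ_L ↑ ℤ³` (`q = 2`, `p = 1 - e^{-2β_c(3)}`), every mesh
`δ > 0` and all data `n, c, r, b', t, b, s`, the box probability of the event
`Uni(b',t) ∩ Patt(b',t) ∩ {every s-ball B̄(b_j,s_j)^δ is joined to (B(c_j,r_j)ᶜ)^δ}` converges as
`L → ∞`. Here the crossing clusters of the annuli are READ at the reading family of closed balls
`B̄(b'_j, t_j)` (connections outside these balls, rim sites = lattice neighbours of these balls),
while the arms start from the inner family `B̄(b_j, s_j)`; no hypothesis on the radii is needed.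

This is the mixed-family analogue of conjunct (iv) of the landed `stub_patternBoxLimits`
(`ArmDressingEvenPatternDecouplingPatternBoxLimits.lean`), and the proof is the same: the event
is the law of finitely many thinned CONNECTION QUERIES of the box configuration — the arms
`K_j ↔ (B(c_j,r_j)ᶜ)^δ` through `ℤ³` with `K_j = B̄(b_j,s_j)^δ` finite, and, through the co-finite
set `O` of lattice sites outside all closed reading balls, `x ↔ O ∖ B(c_j,r_j)^δ` and `x ↔ x'`
for `x, x'` in the finite set `X` of lattice neighbours of the reading balls — and such laws
converge along the wired critical boxes by
`Literature.Probability.LatticeModels.tendsto_rcMeasure_real_thinConnLaw_criticalBeta`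
(ghost-wired connection events are antitone in the box, Grimmett 2006, Lemma (4.13); the wiring
correction is a finite union of one-arm events of fixed lattice points, which vanish at `β_c(3)`
by Edwards–Sokal and Aizenman–Duminil-Copin–Sidoravicius 2015; laws from events by finite
additivity). For `L` so large that `Λ_L` contains `X` and the reading balls, the event is
literally "the answers lie in a fixed set of answer functions".

References: G. Grimmett, *The Random-Cluster Model* (2006), Lemma (4.13), Thm. (4.19);
M. Aizenman, H. Duminil-Copin, V. Sidoravicius, Comm. Math. Phys. 334 (2015), Thm. 1.2.
No definitions, no named facts.
-/

namespace Summit.CriticalPhenomena.Ising3DConformalLimit.Theorems.EvenPatternDecoupling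

open MeasureTheory Finset SimpleGraph Filter Topology
open Literature.Probability.LatticeModels Literature.Probability.Percolation
open Literature.Barriers.CriticalPhenomena

/-! ### The stub -/

-- the registered stub signature is the crux's full `let` preamble, several binders of which
-- (`Pr`, `Supp`, …) are not used by this clause (linter.unusedVariables would flag the verbatim
-- statement)
set_option linter.unusedVariables false in
/-- stub `stub_readingPatternBoxLimit` of the line skeleton of `ArmDressing.EvenPatternDecoupling`
(line `registered`, revision 4), PROVED: **the wired critical FK-Ising box probabilities of the
reading-family pattern event converge as `L → ∞`** — for every mesh `δ > 0` and all data, the event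
`Uni(b',t) ∩ Patt(b',t)` (uniqueness and parity pattern of the crossing clusters read OUTSIDE the
reading balls `B̄(b'_j,t_j)`) intersected with the `s`-ball arms `B̄(b_j,s_j)^δ ↔ (B(c_j,r_j)ᶜ)^δ`.
It is the law of finitely many thinned connection queries with finite or co-finite probes, which
converge along the wired critical boxes of `ℤ³` (ghost-wired events antitone in the box, one-arm
correction `→ m*(β_c(3)) = 0`, finite additivity):
`tendsto_rcMeasure_real_thinConnLaw_criticalBeta`. [cite: Grimmett2006, Thm. (4.19), proof] -/
theorem stub_readingPatternBoxLimit : open Literature.Probability.LatticeModels Literature.Probability.Percolation Literature.Barriers.CriticalPhenomena Filter Topology in let E3:=EuclideanSpace ℝ (Fin 3); let μ : (L : ℕ)→MeasureTheory.Measure (BondConfig (BoxV 3 L)):=fun L=>rcMeasure (boxGraph 3 L) (fkIsingParam (criticalBeta 3)) 2 (boxBoundary 3 L); let PrL : (m : ℕ)→(Fin m→Set (Site 3))→Set (Fin m→Fin m→Prop)→ℕ→ℝ:=fun _ K R L=>(μ L).real {ω | (fun i j=>∃ x y : BoxV 3 L, x.1∈K i∧y.1∈K j∧(openGraph ω).Reachable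 x y)∈R}; let Pr : (m : ℕ)→(Fin m→Set (Site 3))→Set (Fin m→Fin m→Prop)→ℝ:=fun m K R=>limUnder atTop (PrL m K R); let mesh : ℝ→Site 3→E3:=fun δ z=>WithLp.toLp 2 fun i : Fin 3=>δ * (z i : ℝ); let disc : ℝ→Set E3→Set (Site 3):=fun δ A=>{x | mesh δ x∈A}; let EVEN : (n : ℕ)→Set (Fin n→Fin n→Prop):=fun n=>{R | ∀ i, Even ({j : Fin n | R i j}.ncard)}; let EVEN2 : (n : ℕ)→Set (Fin (n + n)→Fin (n + n)→Prop):=fun n=>{R | ∀ i : Fin n, Even ({j : Fin n | R (Fin.castAdd n i) (Fin.castAdd n j)}.ncard)}; let CROSS : (n : ℕ)→Set (Fin (n + n)→Fin (n + n)→Prop):=fun n=>{R | ∀ i : Fin n, R (Fin.castAdd n i) (Fin.natAdd n i)}; let pts : (n : ℕ)→ℝ→(Fin n→E3)→(Fin n→Set (Site 3)):=fun _ δ z j=>{latticeApprox δ (z j)}; let fam : (n : ℕ)→ℝ→(Fin n→Set E3)→(Fin n→Set E3)→(Fin (n + n)→Set (Site 3)):=fun _ δ A B=>Fin.append (fun j=>disc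 δ (A j)) (fun j=>disc δ (B j)); let Supp : (L : ℕ)→Set (BondConfig (BoxV 3 L)):=fun L=>{ω | ω⊆(boxGraph 3 L).edgeSet}; let Ev : (m : ℕ)→(Fin m→Set (Site 3))→Set (Fin m→Fin m→Prop)→(L : ℕ)→Set (BondConfig (BoxV 3 L)):=fun _ K R L=>{ω | (fun i j=>∃ x y : BoxV 3 L, x.1∈K i∧y.1∈K j∧(openGraph ω).Reachable x y)∈R}; let Out : (n : ℕ)→ℝ→(Fin n→E3)→(Fin n→ℝ)→(L : ℕ)→Set (BoxV 3 L):=fun _ δ b s L=>{x | ∀ k, mesh δ x.1∉Metric.closedBall (b k) (s k)}; let RO : (L : ℕ)→BondConfig (BoxV 3 L)→Set (BoxV 3 L)→BoxV 3 L→BoxV 3 L→Prop:=fun L ω O x y=>(SimpleGraph.fromRel fun a a' : BoxV 3 L=>s(a, a')∈ω∧a∈O∧a'∈O).Reachable x y; let Crs : (n : ℕ)→ℝ→(Fin n→E3)→(Fin n→ℝ)→(Fin n→E3)→(Fin n→ℝ)→(L : ℕ)→BondConfig (BoxV 3 L)→Fin n→BoxV 3 L→Prop:=fun n δ c r b s L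 ω j x=>x∈Out n δ b s L∧(∃ y : BoxV 3 L, mesh δ y.1∈Metric.closedBall (b j) (s j)∧(boxGraph 3 L).Adj x y)∧(∃ y : BoxV 3 L, y∈Out n δ b s L∧mesh δ y.1∈(Metric.ball (c j) (r j))ᶜ∧RO L ω (Out n δ b s L) x y); let Uni : (n : ℕ)→ℝ→(Fin n→E3)→(Fin n→ℝ)→(Fin n→E3)→(Fin n→ℝ)→(L : ℕ)→Set (BondConfig (BoxV 3 L)):=fun n δ c r b s L=>{ω | ∀ (j : Fin n) (x x' : BoxV 3 L), Crs n δ c r b s L ω j x→Crs n δ c r b s L ω j x'→RO L ω (Out n δ b s L) x x'}; let Patt : (n : ℕ)→ℝ→(Fin n→E3)→(Fin n→ℝ)→(Fin n→E3)→(Fin n→ℝ)→(L : ℕ)→Set (BondConfig (BoxV 3 L)):=fun n δ c r b s L=>{ω | (fun i j=>∃ x x' : BoxV 3 L, Crs n δ c r b s L ω i x∧Crs n δ c r b s L ω j x'∧RO L ω (Out n δ b s L) x x')∈EVEN n}; ∀ (n : ℕ) (c : Fin n→E3) (r : Fin n→ℝ) (b' : Fin n→E3) (t : Fin n→ℝ)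 (b : Fin n→E3) (s : Fin n→ℝ) (δ : ℝ), 0 < δ→∃ a : ℝ, Tendsto (fun L=>(μ L).real (Uni n δ c r b' t L ∩ Patt n δ c r b' t L ∩ Ev (n + n) (fam n δ (fun j=>Metric.closedBall (b j) (s j)) (fun j=>(Metric.ball (c j) (r j))ᶜ)) (CROSS n) L)) atTop (𝓝 a) := by
  intro E3 μ PrL Pr mesh disc EVEN EVEN2 CROSS pts fam Supp Ev Out RO Crs Uni Patt n c r b' t b s δ
    hδ
  -- the lattice points of closed balls are finite sets; those outside open balls are co-finite sets
  have hballfin : ∀ (b₀ : E3) (s₀ : ℝ), (disc δ (Metric.closedBall b₀ s₀)).Finite := fun b₀ s₀ =>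
    finite_mesh_mem hδ Metric.isBounded_closedBall
  have hcofin : ∀ (c' : E3) (r' : ℝ), (disc δ (Metric.ball c' r')ᶜ)ᶜ.Finite := fun c' r' => by
    have h : (disc δ (Metric.ball c' r')ᶜ)ᶜ = disc δ (Metric.ball c' r') := by
      ext v; simp only [disc, Set.mem_compl_iff, Set.mem_setOf_eq, not_not]
    rw [h]
    exact finite_mesh_mem hδ Metric.isBounded_ball
  -- `Uni ∩ Patt ∩ arms` (read at the reading family `(b', t)`) for finite inner arm probes `Kin j`
  suffices main : ∀ Kin : Fin n → Set (Site 3), (∀ j, (Kin j).Finite) →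
      ∃ a : ℝ, Tendsto (fun L => (μ L).real (Uni n δ c r b' t L ∩ Patt n δ c r b' t L ∩
        Ev (n + n) (Fin.append Kin (fun j => disc δ (Metric.ball (c j) (r j))ᶜ)) (CROSS n) L))
        atTop (𝓝 a) from
    main _ fun j => hballfin (b j) (s j)
  intro Kin hKin
  -- the lattice sites outside the closed reading balls (co-finite), the possible rim sites (finite)
  set O : Set (Site 3) := {v | ∀ k, mesh δ v ∉ Metric.closedBall (b' k) (t k)} with hO
  have hOfin : Oᶜ.Finite := by
    refine (Set.finite_iUnion fun k => hballfin (b' k) (t k)).subset fun v hv => ?_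
    simp only [hO, Set.mem_compl_iff, Set.mem_setOf_eq, not_forall, not_not] at hv
    exact Set.mem_iUnion.2 hv
  have hRimfin : {v : Site 3 | ∃ (j : Fin n) (w : Site 3),
      w ∈ disc δ (Metric.closedBall (b' j) (t j)) ∧ (zdGraph 3).Adj v w}.Finite := by
    refine (Set.finite_iUnion fun j : Fin n => (hballfin (b' j) (t j)).biUnion fun w _ =>
      ((zdGraph 3).neighborSet w).toFinite).subset ?_
    rintro v ⟨j, w, hw, hvw⟩
    exact Set.mem_iUnion.2 ⟨j, Set.mem_iUnion₂.2 ⟨w, hw, hvw.symm⟩⟩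
  set X : Finset (Site 3) := hRimfin.toFinset with hXdef
  have hX : ∀ (v : Site 3) (j : Fin n) (w : Site 3), w ∈ disc δ (Metric.closedBall (b' j) (t j)) →
      (zdGraph 3).Adj v w → v ∈ X := fun v j w hw hvw => hRimfin.mem_toFinset.2 ⟨j, w, hw, hvw⟩
  -- the queries, indexed by `Fin n ⊕ ((X × Fin n) ⊕ (X × X))`: the arms `Kin j ↔ (B(c_j,r_j)ᶜ)^δ`
  -- (through `ℤ³`); through `O`: `x ↔ O ∖ B(c_j,r_j)^δ` and `x ↔ x'` for rim sites `x, x'`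
  set qA : Fin n ⊕ ((↥X × Fin n) ⊕ (↥X × ↥X)) → Set (Site 3) :=
    Sum.elim (fun j => Kin j) (Sum.elim (fun p => {p.1.1}) (fun p => {p.1.1})) with hqA
  set qB : Fin n ⊕ ((↥X × Fin n) ⊕ (↥X × ↥X)) → Set (Site 3) :=
    Sum.elim (fun j => disc δ (Metric.ball (c j) (r j))ᶜ)
      (Sum.elim (fun p => O ∩ disc δ (Metric.ball (c p.2) (r p.2))ᶜ) (fun p => {p.2.1})) with hqB
  set qO : Fin n ⊕ ((↥X × Fin n) ⊕ (↥X × ↥X)) → Set (Site 3) :=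
    Sum.elim (fun _ => Set.univ) (fun _ => O) with hqO
  -- the crossing sites of annulus `j` among `X`, read from the answers `ρ` to the queries
  set CrsQ : (Fin n ⊕ ((↥X × Fin n) ⊕ (↥X × ↥X)) → Prop) → Fin n → ↥X → Prop := fun ρ j x =>
    x.1 ∈ O ∧ (∃ w : Site 3, w ∈ disc δ (Metric.closedBall (b' j) (t j)) ∧ (zdGraph 3).Adj x.1 w) ∧
      ρ (Sum.inr (Sum.inl (x, j))) with hCrsQ
  -- the answer functions for which `Uni ∩ Patt ∩ arms` holds
  set qR : Set (Fin n ⊕ ((↥X × Fin n) ⊕ (↥X × ↥X)) → Prop) :=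
    {ρ | (∀ (j : Fin n) (x x' : ↥X), CrsQ ρ j x → CrsQ ρ j x' → ρ (Sum.inr (Sum.inr (x, x')))) ∧
      (fun i j => ∃ x x' : ↥X, CrsQ ρ i x ∧ CrsQ ρ j x' ∧ ρ (Sum.inr (Sum.inr (x, x')))) ∈ EVEN n ∧
      ∀ j : Fin n, ρ (Sum.inl j)} with hqR
  have hA : ∀ q, (qA q).Finite ∨ (qA q)ᶜ.Finite := by
    rintro (j | (p | p))
    · exact Or.inl (hKin j)
    · exact Or.inl (Set.finite_singleton _)
    · exact Or.inl (Set.finite_singleton _)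
  have hB : ∀ q, (qB q).Finite ∨ (qB q)ᶜ.Finite := by
    rintro (j | (p | p))
    · exact Or.inr (hcofin (c j) (r j))
    · right
      show (O ∩ disc δ (Metric.ball (c p.2) (r p.2))ᶜ)ᶜ.Finite
      rw [Set.compl_inter]
      exact hOfin.union (hcofin (c p.2) (r p.2))
    · exact Or.inl (Set.finite_singleton _)
  obtain ⟨ℓ, hℓ⟩ := tendsto_rcMeasure_real_thinConnLaw_criticalBeta (d := 3) le_rfl
    (A := qA) (B := qB) qO hA hB qR
  -- eventually the box contains the rim sites and the reading balls
  obtain ⟨L₀, hL₀⟩ := exists_subset_box_of_set_finite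
    (X.finite_toSet.union (Set.finite_iUnion fun j : Fin n => hballfin (b' j) (t j)))
  refine ⟨ℓ, hℓ.congr' ?_⟩
  filter_upwards [eventually_ge_atTop L₀] with L hL
  have hsub := hL₀.trans (Finset.coe_subset.2 (box_mono 3 hL))
  have hXL : ∀ v ∈ X, v ∈ box 3 L := fun v hv => Finset.mem_coe.1 (hsub (Set.mem_union_left _ hv))
  have hball : ∀ (j : Fin n) (w : Site 3), w ∈ disc δ (Metric.closedBall (b' j) (t j)) →
      w ∈ box 3 L :=
    fun j w hw => hsub (Set.mem_union_right _ (Set.mem_iUnion.2 ⟨j, hw⟩))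
  -- the two events coincide
  have key : ∀ ω : BondConfig (BoxV 3 L),
      (fun q => ∃ x y : BoxV 3 L, x.1 ∈ qA q ∧ y.1 ∈ qB q ∧
        (openGraph (ω ∩ {e : Sym2 (BoxV 3 L) | ∀ v ∈ e, v.1 ∈ qO q})).Reachable x y) ∈ qR ↔
      ω ∈ Uni n δ c r b' t L ∧ ω ∈ Patt n δ c r b' t L ∧
        ω ∈ Ev (n + n) (Fin.append Kin (fun j => disc δ (Metric.ball (c j) (r j))ᶜ)) (CROSS n)
          L := by
    intro ω
    set ρ : Fin n ⊕ ((↥X × Fin n) ⊕ (↥X × ↥X)) → Prop := fun q => ∃ x y : BoxV 3 L, x.1 ∈ qA q ∧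
      y.1 ∈ qB q ∧ (openGraph (ω ∩ {e : Sym2 (BoxV 3 L) | ∀ v ∈ e, v.1 ∈ qO q})).Reachable x y
      with hρ
    -- `RO` is reachability in the open graph of the configuration thinned to `O`
    have hG : (SimpleGraph.fromRel fun a a' : BoxV 3 L =>
        s(a, a') ∈ ω ∧ a ∈ Out n δ b' t L ∧ a' ∈ Out n δ b' t L) =
        openGraph (ω ∩ {e : Sym2 (BoxV 3 L) | ∀ v ∈ e, v.1 ∈ O}) := by
      ext a a'
      rw [SimpleGraph.fromRel_adj, openGraph_adj, mk_mem_thin_iff, Sym2.eq_swap (a := a') (b := a)]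
      simp only [Out, hO, Set.mem_setOf_eq]
      tauto
    have hRO : ∀ x y : BoxV 3 L, RO L ω (Out n δ b' t L) x y ↔
        (openGraph (ω ∩ {e : Sym2 (BoxV 3 L) | ∀ v ∈ e, v.1 ∈ O})).Reachable x y := by
      intro x y
      show (SimpleGraph.fromRel _).Reachable x y ↔ _
      rw [hG]
    -- crossing sites are rim sites, and `Crs` is read from the answers
    have hmemX : ∀ {j : Fin n} {x : BoxV 3 L}, Crs n δ c r b' t L ω j x → x.1 ∈ X := by
      intro j x hx
      obtain ⟨-, ⟨y, hy, hxy⟩, -⟩ := hx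
      exact hX x.1 j y.1 hy hxy
    have hcrs : ∀ (j : Fin n) (x : BoxV 3 L) (x₀ : ↥X), x₀.1 = x.1 →
        (Crs n δ c r b' t L ω j x ↔ CrsQ ρ j x₀) := by
      intro j x x₀ hx
      simp only [Crs, hCrsQ, hρ, hqA, hqB, hqO, Sum.elim_inr, Sum.elim_inl, hx,
        Set.mem_singleton_iff, Set.mem_inter_iff]
      refine and_congr Iff.rfl (and_congr ⟨?_, ?_⟩ ⟨?_, ?_⟩)
      · rintro ⟨y, hy, hxy⟩
        exact ⟨y.1, hy, hxy⟩
      · rintro ⟨w, hw, hxw⟩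
        exact ⟨⟨w, hball j w hw⟩, hw, hxw⟩
      · rintro ⟨y, hyO, hy, hxy⟩
        exact ⟨x, y, rfl, ⟨hyO, hy⟩, (hRO x y).1 hxy⟩
      · rintro ⟨a, y, ha, ⟨hyO, hy⟩, hay⟩
        have hax : a = x := Subtype.ext ha
        subst hax
        exact ⟨y, hyO, hy, (hRO a y).2 hay⟩
    -- the pair query `x ↔ x'` through `O`
    have hpair : ∀ x x' : ↥X, ρ (Sum.inr (Sum.inr (x, x'))) ↔
        (openGraph (ω ∩ {e : Sym2 (BoxV 3 L) | ∀ v ∈ e, v.1 ∈ O})).Reachable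
          ⟨x.1, hXL _ x.2⟩ ⟨x'.1, hXL _ x'.2⟩ := by
      intro x x'
      simp only [hρ, hqA, hqB, hqO, Sum.elim_inr, Set.mem_singleton_iff]
      constructor
      · rintro ⟨a, y, ha, hy, hay⟩
        have h1 : a = ⟨x.1, hXL _ x.2⟩ := Subtype.ext ha
        have h2 : y = ⟨x'.1, hXL _ x'.2⟩ := Subtype.ext hy
        subst h1 h2
        exact hay
      · exact fun h => ⟨_, _, rfl, rfl, h⟩
    -- the relation `(i, j) ↦ the crossing clusters of the annuli i and j are joined outside the
    -- reading balls`
    have hrel : (fun i j => ∃ x x' : BoxV 3 L, Crs n δ c r b' t L ω i x ∧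
        Crs n δ c r b' t L ω j x' ∧ RO L ω (Out n δ b' t L) x x') =
        fun i j => ∃ x x' : ↥X, CrsQ ρ i x ∧ CrsQ ρ j x' ∧ ρ (Sum.inr (Sum.inr (x, x'))) := by
      funext i j
      apply propext
      constructor
      · rintro ⟨x, x', hx, hx', hxx'⟩
        refine ⟨⟨x.1, hmemX hx⟩, ⟨x'.1, hmemX hx'⟩, (hcrs i x _ rfl).1 hx, (hcrs j x' _ rfl).1 hx',
          ?_⟩
        rw [hpair]
        exact (hRO x x').1 hxx'
      · rintro ⟨x₀, x₀', hx₀, hx₀', hxx'⟩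
        refine ⟨⟨x₀.1, hXL _ x₀.2⟩, ⟨x₀'.1, hXL _ x₀'.2⟩, (hcrs i _ x₀ rfl).2 hx₀,
          (hcrs j _ x₀' rfl).2 hx₀', ?_⟩
        rw [hpair] at hxx'
        exact (hRO _ _).2 hxx'
    simp only [hqR, Set.mem_setOf_eq, Uni, Patt, Ev, CROSS, Fin.append_left, Fin.append_right]
    rw [hrel]
    refine and_congr ⟨fun h j x x' hx hx' => ?_, fun h j x₀ x₀' hx₀ hx₀' => ?_⟩
      (and_congr Iff.rfl (forall_congr' fun j => ?_))
    · -- from the answers to `Uni`: the crossing sites `x, x'` are rim sites, i.e. in `X`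
      have := h j ⟨x.1, hmemX hx⟩ ⟨x'.1, hmemX hx'⟩ ((hcrs j x _ rfl).1 hx)
        ((hcrs j x' _ rfl).1 hx')
      rw [hpair] at this
      exact (hRO x x').2 this
    · -- from `Uni` to the answers
      rw [hpair]
      exact (hRO _ _).1 (h j _ _ ((hcrs j _ x₀ rfl).2 hx₀) ((hcrs j _ x₀' rfl).2 hx₀'))
    · simp only [hρ, hqA, hqB, hqO, Sum.elim_inl, thin_univ]
  show (μ L).real _ = (μ L).real _
  congr 1
  ext ω
  simp only [Set.mem_inter_iff, Set.mem_setOf_eq]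
  rw [and_assoc]
  exact key ω

end Summit.CriticalPhenomena.Ising3DConformalLimit.Theorems.EvenPatternDecoupling
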